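import Summits.QuantumFields.BalabanUV.T4Continuum.Support.SmallCouplingEntryDecayTierB
import Summits.QuantumFields.BalabanUV.T4Continuum.Support.RegularTransportersContour
import Summits.QuantumFields.BalabanUV.T4Continuum.Support.GradientRowSumTransport

/-!
# T⁴ programme, NE2 (U1a) sub-row Δ3 (`T4-U1a.S-NE2-D3-WALK°`) — `hdec` FOR THE TYPED TIER-B PERTURBATION `balabanPert` AT SMALL COUPLING
# (a = 1, cubic unit torus): the transport ENTRY law `hT` DISCHARGED from the regularity class, `hgrad` INHABITED by name

NE2 formalisation swarm `b2b-balaban-t4-ne2-formalise-*`, leaf prover 05 (gen 7); supplier item «Δ3-TIERB-HDEC-REG», the successor file of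
«Δ3-TIERB-HDEC» (`AveragingKernelRows` ∕ `SmallCouplingEntryDecayTierB`, gen 6).  Gen 6's END `SmallCouplingEntryDecayTierB.decayStations_balabanPert`
displays, besides the regularity class `hreg : RegularTransporters L M R α β`, two transport data: the sign `hτ : 0 ≤ τ` and the transport ENTRY
law `hT : ‖T(Γ_{y,j,μ,t}) − 1‖ ≤ τ` along the canonical contours (1.7) + (1.18).  Both FOLLOW from `hreg` alone — row B5's per-bond size
`‖R^{(k)}_ν(x) − 1‖ ≤ α∕n_k`, at most `(d+2)·n_k` bonds per contour on the `(d+1)`-dimensional torus, `(1 + α∕n)^{(d+2)n} ≤ e^{(d+2)α}` — by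
leaf-03's `RegularTransportersContour.norm_transport_contour_sub_one_le_of_regular` BY NAME, with `τ(α) = e^{(d+2)α} − 1`:
 * §1 **`hT_of_regular`**, `tau_nonneg`;
 * §2 **`wrow_avgPert_le_of_regular`** (`Σ_j e^{δ′ρ}‖avgPert(i,j)‖ ≤ ‖a‖(card o)²τ(α)(2+τ(α))e^{2δ′}`), **`wrow_balabanPert_mul_calGlev_le_of_regular`**,
   **`hdec_pertCovC_balabanPert_of_regular`** — gen 6's statements with `hτ`, `hT` replaced by `hreg`;
 * §3 **`decayStations_balabanPert_of_regular`** — the owner's `NE2BalabanDecayRate.decayStations_pertCovC` for the typed `balabanPert L M 1 R P₄`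
   with displayed binders EXACTLY: `hL : 2 ≤ L`; the gradient row-sum datum `hgrad` with its constants `Bg, δg` (INHABITED — see §4); the
   cubic torus `hMc : M = fun _ => N₀`; the rate window `0 ≤ δ′ < min(δg, 1∕(2(d+1)), κ₁₈₃∕(d+1))`; `hreg`; the weighted relative bound
   `hP₄w` of the gauge slot; any tier-B `PerturbationLaws` witness `hpert`; the two coupling discs `htκ`, `ht`;
 * §4 **`decayStations_balabanPert_of_regular_cubic`** — the same with `hgrad` DISCHARGED BY NAME
   (`GradientRowSumTransport.weighted_row_sum_fdiff_inv_le_cubic`, NE3 lineage's `SliceFlatGradient` underneath): `∃ B_∇ δ_∇ > 0` depending on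
   the dimension only such that the stations hold on every King tower over every cubic unit torus.
So, for cubic unit tori at a = 1, referee c14's «hdec (open)» reads after this file: OPEN = the WEIGHTED gauge-slot bound `hP₄w` (the
weighted-row-sum analogue of row B4's `hP₄`; leaf-06-g3's Combes–Thomas chain `CTGaugeSlotDiffEnd` p227253 bounds the slot in the
CONJUGATED operator norm instead) + what `hpert` displays (NE3 by name, `hE`, `hP₄`).

HONEST FRAMING (T4-DAG p. 1).  Bookkeeping over landed modules; MODEL level (tier B = typed operators; no B0 identification with [B9]
(3.23)–(3.26) as printed); a = 1; CUBIC unit tori; small coupling = explicit discs (NOT `‖t‖ ≤ 1`); `hP₄w` DISPLAYED; constants crude;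
nothing printed asserted ([B5] (1.18)∕(1.110), [B9] (3.14)–(3.16)∕(3.35), King (4.38) are TEXT∕SHAPE LOCATIONS); sub-row Δ3 NOT closed for
Bałaban's carrier (a ≠ 1, non-cubic tori, `hP₄w`, NE3 open); **NE2 (U1a) NOT PROVED**; spine PROVED 0/9; NOT infinite volume, NOT a mass
gap, NOT Clay.  HONEST DEPENDENCY: continuum YM on T⁴ ⇐ BetaPertH ∧ nine spine estimates (0/9 proved); BetaPertH ⇐ (D1) ∧ (D4) ∧ CAP+tail;
G-an2-4 gates asym, D1 and NE2/3/4.  ABSOLUTE RULE kept; no `def`; no `sorry`.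
-/

noncomputable section

open scoped BigOperators ComplexConjugate Matrix Matrix.Norms.L2Operator Kronecker
open Finset

namespace Summit.QuantumFields.BalabanUV.T4Continuum.SmallCouplingEntryDecayTierBRegular

open Literature.MathematicalPhysics.QuantumFieldTheory.Balaban1983to89.B5Prop11Plancherel (Tor fine fdiff Cst)
open Literature.MathematicalPhysics.QuantumFieldTheory.Balaban1983to89.B5G183RateUnitTower (lev)
open Literature.MathematicalPhysics.QuantumFieldTheory.Balaban1983to89.B4TorusKernel (periodConst)
open Literature.MathematicalPhysics.QuantumFieldTheory.Balaban1983to89.B4TorusKernel.MultiPeriod (torusSupNorm)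
open Literature.MathematicalPhysics.QuantumFieldTheory.Balaban1983to89.B4Sect5Proof (latticeConst)
open Literature.MathematicalPhysics.QuantumFieldTheory.Balaban1983to89.B5Blocks16 (blockOf)
open Literature.MathematicalPhysics.QuantumFieldTheory.Balaban1983to89.B5DeltaA169 (DeltaA)
open Literature.MathematicalPhysics.QuantumFieldTheory.Balaban1983to89.B5G183Strip (kappa183)
open Literature.MathematicalPhysics.QuantumFieldTheory.Balaban1983to89.B5G183CovDecay (MD183)
open Literature.MathematicalPhysics.QuantumFieldTheory.Balaban1983to89.B6LowerBound2153Torus (rep)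
open Summit.QuantumFields.BalabanUV.T4Continuum
open Summit.QuantumFields.BalabanUV.T4Continuum.BalabanAveragedTowerUnit (idx calGlev)
open Summit.QuantumFields.BalabanUV.T4Continuum.BackgroundResolventTower (PerturbationLaws Cpert)
open Summit.QuantumFields.BalabanUV.T4Continuum.KingPairingPlantedLaw (calDalev JpcT CJ)
open Summit.QuantumFields.BalabanUV.T4Continuum.CovariantBlockAveraging (contour transport)
open Summit.QuantumFields.BalabanUV.T4Continuum.RegularBackgroundTower (RegularTransporters)
open Summit.QuantumFields.BalabanUV.T4Continuum.RegularTransportersContour (norm_transport_contour_sub_one_le_of_regular)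
open Summit.QuantumFields.BalabanUV.T4Continuum.NE2BalabanRoot (avgPert balabanPert)
open Summit.QuantumFields.BalabanUV.T4Continuum.NE2ColourPerturbedLayer (pertCovC pertLimC)
open Summit.QuantumFields.BalabanUV.T4Continuum.DecayRateInterpolation (EntryDecay DecayRate TwoLevelDecayRate)
open Summit.QuantumFields.BalabanUV.T4Continuum.SmallCouplingEntryDecayTierB (wrow_avgPert_le wrow_balabanPert_mul_calGlev_le
  hdec_pertCovC_balabanPert decayStations_balabanPert)
open Summit.QuantumFields.BalabanUV.T4Continuum.GradientRowSumTransport (weighted_row_sum_fdiff_inv_le_cubic)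

variable {d : ℕ} (L : ℕ) [NeZero L] (M : Fin (d + 1) → ℕ) [hM : ∀ μ, NeZero (M μ)]
variable {o : Type*} [Fintype o] [DecidableEq o]

/-! ## §1 The transport entry law from the regularity class -/

/-- `0 ≤ τ(α) = e^{(d+2)α} − 1` for `α ≥ 0`. [folklore] -/
theorem tau_nonneg {α : ℝ} (hα : 0 ≤ α) : 0 ≤ Real.exp ((d + 2 : ℕ) * α) - 1 :=
  sub_nonneg.mpr (Real.one_le_exp (by positivity))

omit hM in
/-- **`hT` FROM `hreg`**: on the `(d+1)`-dimensional torus the transporter of every canonical contour `Γ_{y,j} ∪ [x, x + t·e_μ]`, `t < n_k`,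
is within `τ(α) = e^{(d+2)α} − 1` of the identity, k-UNIFORMLY (leaf-03's `norm_transport_contour_sub_one_le_of_regular` BY NAME). [folklore] -/
theorem hT_of_regular {R : (k : ℕ) → Fin (d + 1) → (idx L M k → Matrix o o ℂ)} {α β : ℝ} (hreg : RegularTransporters L M R α β)
    (k : ℕ) (y : Tor M) (j : Fin (d + 1) → Fin (lev L k)) (μ : Fin (d + 1)) (t : Fin (lev L k)) :
    ‖transport (fine (lev L k) M) (R k) μ (contour (lev L k) M y j μ t) - 1‖ ≤ Real.exp ((d + 2 : ℕ) * α) - 1 :=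
  norm_transport_contour_sub_one_le_of_regular hreg k y μ j t.is_lt.le

/-! ## §2 Gen 6's weighted laws with the transport data discharged -/

/-- **WEIGHTED ROWS OF `avgPert` FROM `hreg`**: `Σ_j e^{δ′ρ}‖(avgPert L M a R k)(i,j)‖ ≤ ‖a‖·(card o)²·τ(α)(2+τ(α))·e^{2δ′}`. [folklore] -/
theorem wrow_avgPert_le_of_regular (a : ℝ) {R : (k : ℕ) → Fin (d + 1) → (idx L M k → Matrix o o ℂ)} {α β : ℝ}
    (hreg : RegularTransporters L M R α β) (k : ℕ) {δ' : ℝ} (hδ : 0 ≤ δ') (i : idx L M k × o) :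
    ∑ j : idx L M k × o, Real.exp (δ' * torusSupNorm M (rep M (blockOf (lev L k) M i.1.1) - rep M (blockOf (lev L k) M j.1.1)))
        * ‖avgPert L M a R k i j‖
      ≤ ‖(a : ℂ)‖ * ((Fintype.card o : ℝ) ^ 2 * ((Real.exp ((d + 2 : ℕ) * α) - 1) * (2 + (Real.exp ((d + 2 : ℕ) * α) - 1)))
          * Real.exp (2 * δ')) :=
  wrow_avgPert_le L M a (tau_nonneg hreg.nonneg.1) k (hT_of_regular L M hreg k) hδ i

/-- **THE WEIGHTED (H-bd) ANALOGUE FOR `balabanPert L M 1 R P₄` FROM `hreg`**: `Σ_j e^{δ′ρ}‖(balabanPert k·(𝒢^{(k)}⊗1))(i,j)‖ ≤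
κ_cov(α, β) + κ_avg(τ(α))·W_G(δ′) + κ₄w` at every level of King's tower over a cubic unit torus. [folklore] -/
theorem wrow_balabanPert_mul_calGlev_le_of_regular {Bg δg : ℝ}
    (hgrad : ∀ (n N₀ : ℕ) [NeZero n] [NeZero N₀] (δ' : ℝ), δ' < δg →
      ∀ (ν : Fin (d + 1)) (i : Tor (fine n (fun _ : Fin (d + 1) => N₀)) × Fin (d + 1)),
        ∑ x' : Tor (fine n (fun _ : Fin (d + 1) => N₀)) × Fin (d + 1),
            Real.exp (δ' * torusSupNorm (fun _ : Fin (d + 1) => N₀)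
                (rep (fun _ : Fin (d + 1) => N₀) (blockOf n (fun _ : Fin (d + 1) => N₀) i.1)
                  - rep (fun _ : Fin (d + 1) => N₀) (blockOf n (fun _ : Fin (d + 1) => N₀) x'.1)))
              * ‖(fdiff (fine n (fun _ : Fin (d + 1) => N₀)) (n : ℂ) ν * (DeltaA n (fun _ : Fin (d + 1) => N₀) 1)⁻¹) i x'‖
          ≤ Bg * latticeConst (d + 1) (δg - δ'))
    (N₀ : ℕ) [NeZero N₀] (hMc : M = fun _ => N₀) {δ' : ℝ} (hδ0 : 0 ≤ δ') (hδg : δ' < δg)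
    (h₁ : δ' < 1 / (2 * ((d : ℝ) + 1))) (h₂ : δ' < kappa183 (d + 1) / (d + 1))
    {R : (k : ℕ) → Fin (d + 1) → (idx L M k → Matrix o o ℂ)} {α β : ℝ} (hreg : RegularTransporters L M R α β)
    {P₄ : (k : ℕ) → Matrix (idx L M k × o) (idx L M k × o) ℂ} {κ₄w : ℝ}
    (hP₄w : ∀ k (i : idx L M k × o), ∑ j, Real.exp (δ' * torusSupNorm M
        (rep M (blockOf (lev L k) M i.1.1) - rep M (blockOf (lev L k) M j.1.1)))
        * ‖(P₄ k * (calGlev L M 1 one_pos k ⊗ₖ (1 : Matrix o o ℂ))) i j‖ ≤ κ₄w)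
    (k : ℕ) (i : idx L M k × o) :
    ∑ j, Real.exp (δ' * torusSupNorm M (rep M (blockOf (lev L k) M i.1.1) - rep M (blockOf (lev L k) M j.1.1)))
        * ‖(balabanPert L M 1 R P₄ k * (calGlev L M 1 one_pos k ⊗ₖ (1 : Matrix o o ℂ))) i j‖
      ≤ (((d + 1) * (((Fintype.card o : ℝ) * α + Real.exp δ' * ((Fintype.card o : ℝ) * α)) * (Bg * latticeConst (d + 1) (δg - δ')))
        + ((d + 1) * (Real.exp δ' * ((Fintype.card o : ℝ) * β)) + (Fintype.card o : ℝ) * (((d + 1 : ℕ) : ℝ) * (α ^ 2 + 2 * β))) * (2 * d * 2 ^ d * Real.exp (1 / (2 * (d + 1))) * latticeConst (d + 1) (1 / (2 * (d + 1)) - δ')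
            + (d + 1) * (MD183 (d + 1) d * periodConst (kappa183 (d + 1)) d * latticeConst (d + 1) (kappa183 (d + 1) / (d + 1) - δ'))))
        + ((Fintype.card o : ℝ) ^ 2 * ((Real.exp ((d + 2 : ℕ) * α) - 1) * (2 + (Real.exp ((d + 2 : ℕ) * α) - 1))) * Real.exp (2 * δ'))
            * (2 * d * 2 ^ d * Real.exp (1 / (2 * (d + 1))) * latticeConst (d + 1) (1 / (2 * (d + 1)) - δ')
            + (d + 1) * (MD183 (d + 1) d * periodConst (kappa183 (d + 1)) d * latticeConst (d + 1) (kappa183 (d + 1) / (d + 1) - δ')))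
        + κ₄w) :=
  wrow_balabanPert_mul_calGlev_le L M hgrad N₀ hMc hδ0 hδg h₁ h₂ hreg (tau_nonneg hreg.nonneg.1) (hT_of_regular L M hreg) hP₄w k i

/-- **`hdec` FOR `balabanPert L M 1 R P₄` AT SMALL COUPLING FROM `hreg` AND `hP₄w`** (cubic unit torus, a = 1): with `κ_w(α, β, δ′, κ₄w)` as in
`wrow_balabanPert_mul_calGlev_le_of_regular` and `‖t‖·κ_w < 1`, EVERY level of the King-averaged colour tower of `(Δ⊗1 + t·balabanPert k)⁻¹` has
entry decay at rate `δ′` with the constant `W_G(δ′)∕(1 − ‖t‖κ_w)`. [folklore] -/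
theorem hdec_pertCovC_balabanPert_of_regular {Bg δg : ℝ}
    (hgrad : ∀ (n N₀ : ℕ) [NeZero n] [NeZero N₀] (δ' : ℝ), δ' < δg →
      ∀ (ν : Fin (d + 1)) (i : Tor (fine n (fun _ : Fin (d + 1) => N₀)) × Fin (d + 1)),
        ∑ x' : Tor (fine n (fun _ : Fin (d + 1) => N₀)) × Fin (d + 1),
            Real.exp (δ' * torusSupNorm (fun _ : Fin (d + 1) => N₀)
                (rep (fun _ : Fin (d + 1) => N₀) (blockOf n (fun _ : Fin (d + 1) => N₀) i.1)
                  - rep (fun _ : Fin (d + 1) => N₀) (blockOf n (fun _ : Fin (d + 1) => N₀) x'.1)))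
              * ‖(fdiff (fine n (fun _ : Fin (d + 1) => N₀)) (n : ℂ) ν * (DeltaA n (fun _ : Fin (d + 1) => N₀) 1)⁻¹) i x'‖
          ≤ Bg * latticeConst (d + 1) (δg - δ'))
    (N₀ : ℕ) [NeZero N₀] (hMc : M = fun _ => N₀) {δ' : ℝ} (hδ0 : 0 ≤ δ') (hδg : δ' < δg)
    (h₁ : δ' < 1 / (2 * ((d : ℝ) + 1))) (h₂ : δ' < kappa183 (d + 1) / (d + 1))
    {R : (k : ℕ) → Fin (d + 1) → (idx L M k → Matrix o o ℂ)} {α β : ℝ} (hreg : RegularTransporters L M R α β)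
    {P₄ : (k : ℕ) → Matrix (idx L M k × o) (idx L M k × o) ℂ} {κ₄w : ℝ}
    (hP₄w : ∀ k (i : idx L M k × o), ∑ j, Real.exp (δ' * torusSupNorm M
        (rep M (blockOf (lev L k) M i.1.1) - rep M (blockOf (lev L k) M j.1.1)))
        * ‖(P₄ k * (calGlev L M 1 one_pos k ⊗ₖ (1 : Matrix o o ℂ))) i j‖ ≤ κ₄w)
    {t : ℂ} (ht : ‖t‖ * (((d + 1) * (((Fintype.card o : ℝ) * α + Real.exp δ' * ((Fintype.card o : ℝ) * α)) * (Bg * latticeConst (d + 1) (δg - δ')))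
        + ((d + 1) * (Real.exp δ' * ((Fintype.card o : ℝ) * β)) + (Fintype.card o : ℝ) * (((d + 1 : ℕ) : ℝ) * (α ^ 2 + 2 * β))) * (2 * d * 2 ^ d * Real.exp (1 / (2 * (d + 1))) * latticeConst (d + 1) (1 / (2 * (d + 1)) - δ')
            + (d + 1) * (MD183 (d + 1) d * periodConst (kappa183 (d + 1)) d * latticeConst (d + 1) (kappa183 (d + 1) / (d + 1) - δ'))))
        + ((Fintype.card o : ℝ) ^ 2 * ((Real.exp ((d + 2 : ℕ) * α) - 1) * (2 + (Real.exp ((d + 2 : ℕ) * α) - 1))) * Real.exp (2 * δ'))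
            * (2 * d * 2 ^ d * Real.exp (1 / (2 * (d + 1))) * latticeConst (d + 1) (1 / (2 * (d + 1)) - δ')
            + (d + 1) * (MD183 (d + 1) d * periodConst (kappa183 (d + 1)) d * latticeConst (d + 1) (kappa183 (d + 1) / (d + 1) - δ')))
        + κ₄w) < 1) (k : ℕ) :
    EntryDecay (fun x y : idx L M 0 × o => torusSupNorm M (fun ν => (((x.1.1 ν).val : ℕ) : ℤ) - (((y.1.1 ν).val : ℕ) : ℤ)))
      (pertCovC L M 1 one_pos (balabanPert L M 1 R P₄) t k) ((2 * d * 2 ^ d * Real.exp (1 / (2 * (d + 1))) * latticeConst (d + 1) (1 / (2 * (d + 1)) - δ')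
            + (d + 1) * (MD183 (d + 1) d * periodConst (kappa183 (d + 1)) d * latticeConst (d + 1) (kappa183 (d + 1) / (d + 1) - δ')))
        / (1 - ‖t‖ * (((d + 1) * (((Fintype.card o : ℝ) * α + Real.exp δ' * ((Fintype.card o : ℝ) * α)) * (Bg * latticeConst (d + 1) (δg - δ')))
        + ((d + 1) * (Real.exp δ' * ((Fintype.card o : ℝ) * β)) + (Fintype.card o : ℝ) * (((d + 1 : ℕ) : ℝ) * (α ^ 2 + 2 * β))) * (2 * d * 2 ^ d * Real.exp (1 / (2 * (d + 1))) * latticeConst (d + 1) (1 / (2 * (d + 1)) - δ')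
            + (d + 1) * (MD183 (d + 1) d * periodConst (kappa183 (d + 1)) d * latticeConst (d + 1) (kappa183 (d + 1) / (d + 1) - δ'))))
        + ((Fintype.card o : ℝ) ^ 2 * ((Real.exp ((d + 2 : ℕ) * α) - 1) * (2 + (Real.exp ((d + 2 : ℕ) * α) - 1))) * Real.exp (2 * δ'))
            * (2 * d * 2 ^ d * Real.exp (1 / (2 * (d + 1))) * latticeConst (d + 1) (1 / (2 * (d + 1)) - δ')
            + (d + 1) * (MD183 (d + 1) d * periodConst (kappa183 (d + 1)) d * latticeConst (d + 1) (kappa183 (d + 1) / (d + 1) - δ')))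
        + κ₄w))) δ' :=
  hdec_pertCovC_balabanPert L M hgrad N₀ hMc hδ0 hδg h₁ h₂ hreg (tau_nonneg hreg.nonneg.1) (hT_of_regular L M hreg) hP₄w ht k

/-! ## §3 ROOT B's decay stations for the typed perturbation: `hreg`, `hP₄w`, `hpert` displayed -/

/-- **ROOT B's DECAY STATIONS FOR `balabanPert L M 1 R P₄`, TRANSPORT DATA DISCHARGED** (`L ≥ 2`, a = 1, cubic unit torus `M ≡ N₀`).
Displayed binders, completely: the gradient row-sum datum `hgrad` with its constants `Bg, δg` (inhabited by name, §4); the rate window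
`0 ≤ δ′ < min(δg, 1∕(2(d+1)), κ₁₈₃∕(d+1))`; the regularity class `hreg` (row B5's shape); the WEIGHTED relative bound `hP₄w` of the gauge
slot (OPEN for Bałaban's slot in this currency); ANY tier-B `PerturbationLaws` witness `hpert` (e.g. `NE2BalabanRoot.perturbationLaws_balaban`,
itself CONDITIONAL on node NE3, `hE`, `hP₄` as displayed there); the two coupling discs `htκ : ‖t‖κ < 1`, `ht : ‖t‖κ_w < 1`.  Conclusion:
the owner's `NE2BalabanDecayRate.decayStations_pertCovC` — limit entry decay of `pertLimC`, King's (4.38) limit rate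
`DecayRate … (δ′∕2) √(L⁻¹)`, and the two-level rate.  MODEL level; NE2 NOT proved. [cite: King1986, Lemma 4.5 (4.38) p.674 (shape)] [folklore] -/
theorem decayStations_balabanPert_of_regular (hL : 2 ≤ L) {Bg δg : ℝ}
    (hgrad : ∀ (n N₀ : ℕ) [NeZero n] [NeZero N₀] (δ' : ℝ), δ' < δg →
      ∀ (ν : Fin (d + 1)) (i : Tor (fine n (fun _ : Fin (d + 1) => N₀)) × Fin (d + 1)),
        ∑ x' : Tor (fine n (fun _ : Fin (d + 1) => N₀)) × Fin (d + 1),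
            Real.exp (δ' * torusSupNorm (fun _ : Fin (d + 1) => N₀)
                (rep (fun _ : Fin (d + 1) => N₀) (blockOf n (fun _ : Fin (d + 1) => N₀) i.1)
                  - rep (fun _ : Fin (d + 1) => N₀) (blockOf n (fun _ : Fin (d + 1) => N₀) x'.1)))
              * ‖(fdiff (fine n (fun _ : Fin (d + 1) => N₀)) (n : ℂ) ν * (DeltaA n (fun _ : Fin (d + 1) => N₀) 1)⁻¹) i x'‖
          ≤ Bg * latticeConst (d + 1) (δg - δ'))
    (N₀ : ℕ) [NeZero N₀] (hMc : M = fun _ => N₀) {δ' : ℝ} (hδ0 : 0 ≤ δ') (hδg : δ' < δg)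
    (h₁ : δ' < 1 / (2 * ((d : ℝ) + 1))) (h₂ : δ' < kappa183 (d + 1) / (d + 1))
    {R : (k : ℕ) → Fin (d + 1) → (idx L M k → Matrix o o ℂ)} {α β : ℝ} (hreg : RegularTransporters L M R α β)
    {P₄ : (k : ℕ) → Matrix (idx L M k × o) (idx L M k × o) ℂ} {κ₄w : ℝ}
    (hP₄w : ∀ k (i : idx L M k × o), ∑ j, Real.exp (δ' * torusSupNorm M
        (rep M (blockOf (lev L k) M i.1.1) - rep M (blockOf (lev L k) M j.1.1)))
        * ‖(P₄ k * (calGlev L M 1 one_pos k ⊗ₖ (1 : Matrix o o ℂ))) i j‖ ≤ κ₄w)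
    {κ C₂ : ℝ} (hpert : PerturbationLaws (fun k => calDalev L M 1 one_pos k ⊗ₖ (1 : Matrix o o ℂ)) (balabanPert L M 1 R P₄)
      (fun k => JpcT L M k ⊗ₖ (1 : Matrix o o ℂ)) κ (fun k => C₂ * ((L : ℝ)⁻¹) ^ k))
    {t : ℂ} (htκ : ‖t‖ * κ < 1) (ht : ‖t‖ * (((d + 1) * (((Fintype.card o : ℝ) * α + Real.exp δ' * ((Fintype.card o : ℝ) * α)) * (Bg * latticeConst (d + 1) (δg - δ')))
        + ((d + 1) * (Real.exp δ' * ((Fintype.card o : ℝ) * β)) + (Fintype.card o : ℝ) * (((d + 1 : ℕ) : ℝ) * (α ^ 2 + 2 * β))) * (2 * d * 2 ^ d * Real.exp (1 / (2 * (d + 1))) * latticeConst (d + 1) (1 / (2 * (d + 1)) - δ')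
            + (d + 1) * (MD183 (d + 1) d * periodConst (kappa183 (d + 1)) d * latticeConst (d + 1) (kappa183 (d + 1) / (d + 1) - δ'))))
        + ((Fintype.card o : ℝ) ^ 2 * ((Real.exp ((d + 2 : ℕ) * α) - 1) * (2 + (Real.exp ((d + 2 : ℕ) * α) - 1))) * Real.exp (2 * δ'))
            * (2 * d * 2 ^ d * Real.exp (1 / (2 * (d + 1))) * latticeConst (d + 1) (1 / (2 * (d + 1)) - δ')
            + (d + 1) * (MD183 (d + 1) d * periodConst (kappa183 (d + 1)) d * latticeConst (d + 1) (kappa183 (d + 1) / (d + 1) - δ')))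
        + κ₄w) < 1) :
    EntryDecay (fun x y : idx L M 0 × o => torusSupNorm M (fun ν => (((x.1.1 ν).val : ℕ) : ℤ) - (((y.1.1 ν).val : ℕ) : ℤ)))
        (pertLimC L M 1 one_pos (balabanPert L M 1 R P₄) t) ((2 * d * 2 ^ d * Real.exp (1 / (2 * (d + 1))) * latticeConst (d + 1) (1 / (2 * (d + 1)) - δ')
            + (d + 1) * (MD183 (d + 1) d * periodConst (kappa183 (d + 1)) d * latticeConst (d + 1) (kappa183 (d + 1) / (d + 1) - δ')))
          / (1 - ‖t‖ * (((d + 1) * (((Fintype.card o : ℝ) * α + Real.exp δ' * ((Fintype.card o : ℝ) * α)) * (Bg * latticeConst (d + 1) (δg - δ')))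
        + ((d + 1) * (Real.exp δ' * ((Fintype.card o : ℝ) * β)) + (Fintype.card o : ℝ) * (((d + 1 : ℕ) : ℝ) * (α ^ 2 + 2 * β))) * (2 * d * 2 ^ d * Real.exp (1 / (2 * (d + 1))) * latticeConst (d + 1) (1 / (2 * (d + 1)) - δ')
            + (d + 1) * (MD183 (d + 1) d * periodConst (kappa183 (d + 1)) d * latticeConst (d + 1) (kappa183 (d + 1) / (d + 1) - δ'))))
        + ((Fintype.card o : ℝ) ^ 2 * ((Real.exp ((d + 2 : ℕ) * α) - 1) * (2 + (Real.exp ((d + 2 : ℕ) * α) - 1))) * Real.exp (2 * δ'))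
            * (2 * d * 2 ^ d * Real.exp (1 / (2 * (d + 1))) * latticeConst (d + 1) (1 / (2 * (d + 1)) - δ')
            + (d + 1) * (MD183 (d + 1) d * periodConst (kappa183 (d + 1)) d * latticeConst (d + 1) (kappa183 (d + 1) / (d + 1) - δ')))
        + κ₄w))) δ' ∧
      DecayRate (fun x y : idx L M 0 × o => torusSupNorm M (fun ν => (((x.1.1 ν).val : ℕ) : ℤ) - (((y.1.1 ν).val : ℕ) : ℤ)))
        (pertCovC L M 1 one_pos (balabanPert L M 1 R P₄) t) (pertLimC L M 1 one_pos (balabanPert L M 1 R P₄) t)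
        (Real.sqrt (2 * ((2 * d * 2 ^ d * Real.exp (1 / (2 * (d + 1))) * latticeConst (d + 1) (1 / (2 * (d + 1)) - δ')
            + (d + 1) * (MD183 (d + 1) d * periodConst (kappa183 (d + 1)) d * latticeConst (d + 1) (kappa183 (d + 1) / (d + 1) - δ')))
          / (1 - ‖t‖ * (((d + 1) * (((Fintype.card o : ℝ) * α + Real.exp δ' * ((Fintype.card o : ℝ) * α)) * (Bg * latticeConst (d + 1) (δg - δ')))
        + ((d + 1) * (Real.exp δ' * ((Fintype.card o : ℝ) * β)) + (Fintype.card o : ℝ) * (((d + 1 : ℕ) : ℝ) * (α ^ 2 + 2 * β))) * (2 * d * 2 ^ d * Real.exp (1 / (2 * (d + 1))) * latticeConst (d + 1) (1 / (2 * (d + 1)) - δ')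
            + (d + 1) * (MD183 (d + 1) d * periodConst (kappa183 (d + 1)) d * latticeConst (d + 1) (kappa183 (d + 1) / (d + 1) - δ'))))
        + ((Fintype.card o : ℝ) ^ 2 * ((Real.exp ((d + 2 : ℕ) * α) - 1) * (2 + (Real.exp ((d + 2 : ℕ) * α) - 1))) * Real.exp (2 * δ'))
            * (2 * d * 2 ^ d * Real.exp (1 / (2 * (d + 1))) * latticeConst (d + 1) (1 / (2 * (d + 1)) - δ')
            + (d + 1) * (MD183 (d + 1) d * periodConst (kappa183 (d + 1)) d * latticeConst (d + 1) (kappa183 (d + 1) / (d + 1) - δ')))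
        + κ₄w)))
          * (Cpert κ (2 * ((d + 1 : ℕ) : ℝ) * Cst (d + 1) 1) (CJ (d + 1) 1) C₂ 0 t / (1 - (L : ℝ)⁻¹)))) (δ' / 2) (Real.sqrt ((L : ℝ)⁻¹)) ∧
      TwoLevelDecayRate (fun x y : idx L M 0 × o => torusSupNorm M (fun ν => (((x.1.1 ν).val : ℕ) : ℤ) - (((y.1.1 ν).val : ℕ) : ℤ)))
        (pertCovC L M 1 one_pos (balabanPert L M 1 R P₄) t)
        (Real.sqrt (2 * ((2 * d * 2 ^ d * Real.exp (1 / (2 * (d + 1))) * latticeConst (d + 1) (1 / (2 * (d + 1)) - δ')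
            + (d + 1) * (MD183 (d + 1) d * periodConst (kappa183 (d + 1)) d * latticeConst (d + 1) (kappa183 (d + 1) / (d + 1) - δ')))
          / (1 - ‖t‖ * (((d + 1) * (((Fintype.card o : ℝ) * α + Real.exp δ' * ((Fintype.card o : ℝ) * α)) * (Bg * latticeConst (d + 1) (δg - δ')))
        + ((d + 1) * (Real.exp δ' * ((Fintype.card o : ℝ) * β)) + (Fintype.card o : ℝ) * (((d + 1 : ℕ) : ℝ) * (α ^ 2 + 2 * β))) * (2 * d * 2 ^ d * Real.exp (1 / (2 * (d + 1))) * latticeConst (d + 1) (1 / (2 * (d + 1)) - δ')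
            + (d + 1) * (MD183 (d + 1) d * periodConst (kappa183 (d + 1)) d * latticeConst (d + 1) (kappa183 (d + 1) / (d + 1) - δ'))))
        + ((Fintype.card o : ℝ) ^ 2 * ((Real.exp ((d + 2 : ℕ) * α) - 1) * (2 + (Real.exp ((d + 2 : ℕ) * α) - 1))) * Real.exp (2 * δ'))
            * (2 * d * 2 ^ d * Real.exp (1 / (2 * (d + 1))) * latticeConst (d + 1) (1 / (2 * (d + 1)) - δ')
            + (d + 1) * (MD183 (d + 1) d * periodConst (kappa183 (d + 1)) d * latticeConst (d + 1) (kappa183 (d + 1) / (d + 1) - δ')))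
        + κ₄w)))
          * (2 * Cpert κ (2 * ((d + 1 : ℕ) : ℝ) * Cst (d + 1) 1) (CJ (d + 1) 1) C₂ 0 t / (1 - (L : ℝ)⁻¹)))) (δ' / 2) (Real.sqrt ((L : ℝ)⁻¹)) :=
  decayStations_balabanPert L M hL hgrad N₀ hMc hδ0 hδg h₁ h₂ hreg (tau_nonneg hreg.nonneg.1) (hT_of_regular L M hreg) hP₄w hpert htκ ht

/-! ## §4 `hgrad` inhabited by name: the packaged END -/

/-- **THE PACKAGED END** (`L ≥ 2`, a = 1): there are `B_∇, δ_∇ > 0` depending on the dimension only (the NE3 lineage's `SliceFlatGradient`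
constants through `GradientRowSumTransport.weighted_row_sum_fdiff_inv_le_cubic`) such that §3 holds with them on every King tower over every
cubic unit torus — displayed: the cubic torus, the rate window, `hreg`, `hP₄w`, `hpert`, the two discs; nothing else. [folklore] -/
theorem decayStations_balabanPert_of_regular_cubic (hL : 2 ≤ L) :
    ∃ Bg δg : ℝ, 0 < Bg ∧ 0 < δg ∧ ∀ (N₀ : ℕ) [NeZero N₀], M = (fun _ => N₀) →
      ∀ (δ' : ℝ), 0 ≤ δ' → δ' < δg → δ' < 1 / (2 * ((d : ℝ) + 1)) → δ' < kappa183 (d + 1) / (d + 1) →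
      ∀ (R : (k : ℕ) → Fin (d + 1) → (idx L M k → Matrix o o ℂ)) (α β : ℝ), RegularTransporters L M R α β →
      ∀ (P₄ : (k : ℕ) → Matrix (idx L M k × o) (idx L M k × o) ℂ) (κ₄w : ℝ),
        (∀ k (i : idx L M k × o), ∑ j, Real.exp (δ' * torusSupNorm M
          (rep M (blockOf (lev L k) M i.1.1) - rep M (blockOf (lev L k) M j.1.1)))
          * ‖(P₄ k * (calGlev L M 1 one_pos k ⊗ₖ (1 : Matrix o o ℂ))) i j‖ ≤ κ₄w) →
      ∀ (κ C₂ : ℝ), PerturbationLaws (fun k => calDalev L M 1 one_pos k ⊗ₖ (1 : Matrix o o ℂ)) (balabanPert L M 1 R P₄)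
          (fun k => JpcT L M k ⊗ₖ (1 : Matrix o o ℂ)) κ (fun k => C₂ * ((L : ℝ)⁻¹) ^ k) →
      ∀ (t : ℂ), ‖t‖ * κ < 1 → ‖t‖ * (((d + 1) * (((Fintype.card o : ℝ) * α + Real.exp δ' * ((Fintype.card o : ℝ) * α)) * (Bg * latticeConst (d + 1) (δg - δ')))
        + ((d + 1) * (Real.exp δ' * ((Fintype.card o : ℝ) * β)) + (Fintype.card o : ℝ) * (((d + 1 : ℕ) : ℝ) * (α ^ 2 + 2 * β))) * (2 * d * 2 ^ d * Real.exp (1 / (2 * (d + 1))) * latticeConst (d + 1) (1 / (2 * (d + 1)) - δ')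
            + (d + 1) * (MD183 (d + 1) d * periodConst (kappa183 (d + 1)) d * latticeConst (d + 1) (kappa183 (d + 1) / (d + 1) - δ'))))
        + ((Fintype.card o : ℝ) ^ 2 * ((Real.exp ((d + 2 : ℕ) * α) - 1) * (2 + (Real.exp ((d + 2 : ℕ) * α) - 1))) * Real.exp (2 * δ'))
            * (2 * d * 2 ^ d * Real.exp (1 / (2 * (d + 1))) * latticeConst (d + 1) (1 / (2 * (d + 1)) - δ')
            + (d + 1) * (MD183 (d + 1) d * periodConst (kappa183 (d + 1)) d * latticeConst (d + 1) (kappa183 (d + 1) / (d + 1) - δ')))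
        + κ₄w) < 1 →
      EntryDecay (fun x y : idx L M 0 × o => torusSupNorm M (fun ν => (((x.1.1 ν).val : ℕ) : ℤ) - (((y.1.1 ν).val : ℕ) : ℤ)))
        (pertLimC L M 1 one_pos (balabanPert L M 1 R P₄) t) ((2 * d * 2 ^ d * Real.exp (1 / (2 * (d + 1))) * latticeConst (d + 1) (1 / (2 * (d + 1)) - δ')
            + (d + 1) * (MD183 (d + 1) d * periodConst (kappa183 (d + 1)) d * latticeConst (d + 1) (kappa183 (d + 1) / (d + 1) - δ')))
          / (1 - ‖t‖ * (((d + 1) * (((Fintype.card o : ℝ) * α + Real.exp δ' * ((Fintype.card o : ℝ) * α)) * (Bg * latticeConst (d + 1) (δg - δ')))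
        + ((d + 1) * (Real.exp δ' * ((Fintype.card o : ℝ) * β)) + (Fintype.card o : ℝ) * (((d + 1 : ℕ) : ℝ) * (α ^ 2 + 2 * β))) * (2 * d * 2 ^ d * Real.exp (1 / (2 * (d + 1))) * latticeConst (d + 1) (1 / (2 * (d + 1)) - δ')
            + (d + 1) * (MD183 (d + 1) d * periodConst (kappa183 (d + 1)) d * latticeConst (d + 1) (kappa183 (d + 1) / (d + 1) - δ'))))
        + ((Fintype.card o : ℝ) ^ 2 * ((Real.exp ((d + 2 : ℕ) * α) - 1) * (2 + (Real.exp ((d + 2 : ℕ) * α) - 1))) * Real.exp (2 * δ'))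
            * (2 * d * 2 ^ d * Real.exp (1 / (2 * (d + 1))) * latticeConst (d + 1) (1 / (2 * (d + 1)) - δ')
            + (d + 1) * (MD183 (d + 1) d * periodConst (kappa183 (d + 1)) d * latticeConst (d + 1) (kappa183 (d + 1) / (d + 1) - δ')))
        + κ₄w))) δ' ∧
      DecayRate (fun x y : idx L M 0 × o => torusSupNorm M (fun ν => (((x.1.1 ν).val : ℕ) : ℤ) - (((y.1.1 ν).val : ℕ) : ℤ)))
        (pertCovC L M 1 one_pos (balabanPert L M 1 R P₄) t) (pertLimC L M 1 one_pos (balabanPert L M 1 R P₄) t)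
        (Real.sqrt (2 * ((2 * d * 2 ^ d * Real.exp (1 / (2 * (d + 1))) * latticeConst (d + 1) (1 / (2 * (d + 1)) - δ')
            + (d + 1) * (MD183 (d + 1) d * periodConst (kappa183 (d + 1)) d * latticeConst (d + 1) (kappa183 (d + 1) / (d + 1) - δ')))
          / (1 - ‖t‖ * (((d + 1) * (((Fintype.card o : ℝ) * α + Real.exp δ' * ((Fintype.card o : ℝ) * α)) * (Bg * latticeConst (d + 1) (δg - δ')))
        + ((d + 1) * (Real.exp δ' * ((Fintype.card o : ℝ) * β)) + (Fintype.card o : ℝ) * (((d + 1 : ℕ) : ℝ) * (α ^ 2 + 2 * β))) * (2 * d * 2 ^ d * Real.exp (1 / (2 * (d + 1))) * latticeConst (d + 1) (1 / (2 * (d + 1)) - δ')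
            + (d + 1) * (MD183 (d + 1) d * periodConst (kappa183 (d + 1)) d * latticeConst (d + 1) (kappa183 (d + 1) / (d + 1) - δ'))))
        + ((Fintype.card o : ℝ) ^ 2 * ((Real.exp ((d + 2 : ℕ) * α) - 1) * (2 + (Real.exp ((d + 2 : ℕ) * α) - 1))) * Real.exp (2 * δ'))
            * (2 * d * 2 ^ d * Real.exp (1 / (2 * (d + 1))) * latticeConst (d + 1) (1 / (2 * (d + 1)) - δ')
            + (d + 1) * (MD183 (d + 1) d * periodConst (kappa183 (d + 1)) d * latticeConst (d + 1) (kappa183 (d + 1) / (d + 1) - δ')))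
        + κ₄w)))
          * (Cpert κ (2 * ((d + 1 : ℕ) : ℝ) * Cst (d + 1) 1) (CJ (d + 1) 1) C₂ 0 t / (1 - (L : ℝ)⁻¹)))) (δ' / 2) (Real.sqrt ((L : ℝ)⁻¹)) ∧
      TwoLevelDecayRate (fun x y : idx L M 0 × o => torusSupNorm M (fun ν => (((x.1.1 ν).val : ℕ) : ℤ) - (((y.1.1 ν).val : ℕ) : ℤ)))
        (pertCovC L M 1 one_pos (balabanPert L M 1 R P₄) t)
        (Real.sqrt (2 * ((2 * d * 2 ^ d * Real.exp (1 / (2 * (d + 1))) * latticeConst (d + 1) (1 / (2 * (d + 1)) - δ')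
            + (d + 1) * (MD183 (d + 1) d * periodConst (kappa183 (d + 1)) d * latticeConst (d + 1) (kappa183 (d + 1) / (d + 1) - δ')))
          / (1 - ‖t‖ * (((d + 1) * (((Fintype.card o : ℝ) * α + Real.exp δ' * ((Fintype.card o : ℝ) * α)) * (Bg * latticeConst (d + 1) (δg - δ')))
        + ((d + 1) * (Real.exp δ' * ((Fintype.card o : ℝ) * β)) + (Fintype.card o : ℝ) * (((d + 1 : ℕ) : ℝ) * (α ^ 2 + 2 * β))) * (2 * d * 2 ^ d * Real.exp (1 / (2 * (d + 1))) * latticeConst (d + 1) (1 / (2 * (d + 1)) - δ')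
            + (d + 1) * (MD183 (d + 1) d * periodConst (kappa183 (d + 1)) d * latticeConst (d + 1) (kappa183 (d + 1) / (d + 1) - δ'))))
        + ((Fintype.card o : ℝ) ^ 2 * ((Real.exp ((d + 2 : ℕ) * α) - 1) * (2 + (Real.exp ((d + 2 : ℕ) * α) - 1))) * Real.exp (2 * δ'))
            * (2 * d * 2 ^ d * Real.exp (1 / (2 * (d + 1))) * latticeConst (d + 1) (1 / (2 * (d + 1)) - δ')
            + (d + 1) * (MD183 (d + 1) d * periodConst (kappa183 (d + 1)) d * latticeConst (d + 1) (kappa183 (d + 1) / (d + 1) - δ')))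
        + κ₄w)))
          * (2 * Cpert κ (2 * ((d + 1 : ℕ) : ℝ) * Cst (d + 1) 1) (CJ (d + 1) 1) C₂ 0 t / (1 - (L : ℝ)⁻¹)))) (δ' / 2) (Real.sqrt ((L : ℝ)⁻¹)) := by
  obtain ⟨Bg, δg, hB, hδ, hgrad⟩ := weighted_row_sum_fdiff_inv_le_cubic (d := d)
  exact ⟨Bg, δg, hB, hδ, fun N₀ _ hMc δ' hδ0 hδg h₁ h₂ R α β hreg P₄ κ₄w hP₄w κ C₂ hpert t htκ ht =>
    decayStations_balabanPert_of_regular L M hL hgrad N₀ hMc hδ0 hδg h₁ h₂ hreg hP₄w hpert htκ ht⟩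

/-- kernel `example` — K-TEST AT THE TRIVIAL BACKGROUND: for `R ≡ 1` the regularity class holds with `α = β = 0` and the averaging summand has
weighted rows `≤ 0` by §2 (`τ(0) = 0`) — consistent with `NE2BalabanRoot.avgPert_trivial` (`avgPert … 1 = 0`). [folklore] -/
example (a : ℝ) (k : ℕ) {δ' : ℝ} (hδ : 0 ≤ δ') (i : idx L M k × o)
    (hreg : RegularTransporters L M (fun _ _ _ => (1 : Matrix o o ℂ)) 0 0) :
    ∑ j : idx L M k × o, Real.exp (δ' * torusSupNorm M (rep M (blockOf (lev L k) M i.1.1) - rep M (blockOf (lev L k) M j.1.1)))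
        * ‖avgPert L M a (fun _ _ _ => (1 : Matrix o o ℂ)) k i j‖ ≤ 0 := by
  have h := wrow_avgPert_le_of_regular L M a hreg k hδ i
  simpa using h

end Summit.QuantumFields.BalabanUV.T4Continuum.SmallCouplingEntryDecayTierBRegular

end
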